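import Summits.HubbardSuperconductivity.HubbardSuperconductivity.Theorems.ThermalWedgeTwSeededEnsembleEquivalenceRFreeConcavityCalibration
import Literature.MathematicalPhysics.QuantumLattice.DWaveSourceLeeYang
import Literature.MathematicalPhysics.QuantumLattice.DWaveSourceProofs
import Literature.MathematicalPhysics.QuantumLattice.TransverseWardIdentity

/-!
# Crux `TwSeededEnsembleEquivalenceR` (stmt-HubbardSuperconductivity-15581), line `cold-floor-collapse` (slug `Sketch`),
# skeleton v10 — calibration: the registered physics stub DEEP-SIGN holds at the solvable corner `U = 0`

Support file (`--supports stmt-HubbardSuperconductivity-15581`; sorry-free; no definition; route-file free).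

Skeleton v10 (lead c11) registers ONE physics stub, `stub_fvDeepAnomalousSign`: eventually in `L`, at `β = e^{a/U}` and deep
sources `h ∈ (e^{−a/(4U)}, 13g+1)`, the truncated ANOMALOUS Duhamel d-wave pair correlator of the sourced torus is non-positive,
`Re (Δ_d,Δ_d)_{Duh} ≤ (Re⟨Δ_d⟩)²` (equivalently `χ∥ ≤ χ⊥`, equivalently concavity of the sourced pressure in `s = h²`;
`Theorems/…RWardReduction.lean`, `Literature/…/TransverseWardIdentity.lean`). This file proves the statement at `U = 0`
EXACTLY — for every inverse temperature `β > 0`, every `μ`, every torus side `L ≥ 3` and every source `h > 0`: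

* `cal_freeAnomalousSign_finiteVolume` — `Re (Δ_d,Δ_d)_{Duh; β, dWaveSourceTorus L 0 μ h} ≤ (Re⟨Δ_d⟩_{β, dWaveSourceTorus L 0 μ h})²`,
  from the free finite-volume concavity `cal_freeConcavity_finiteVolume` (BdG mode sum, each mode concave in `s`) and the
  CONVERSE Ward dictionary `anomalous_nonpos_of_concaveOn_sq_source` (concave ⇒ antitone chord susceptibility ⇒ sign);
* `cal_freeDeepAnomalousSign` — the same in the quantifier shape of the registered stub, binder for binder, with
  `dWaveSourceTorus L U μ h`, `β = e^{a/U}` replaced by `dWaveSourceTorus L 0 μ h`, any `β > 0` (witnesses `a₁ = K' = U₀ = 1`,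
  `L₀ = 3`; no floor is needed at `U = 0`).

So the physics left in DEEP-SIGN is the relative `O(U) + O(a)` control of ONE truncated two-point function of the interacting
sourced torus at `β = e^{a/U}` above the floor `e^{−a/(4U)} ≫ T` (constructive-RG class); at `U = 0` there is no floor and no
smallness of the temperature. [folklore: the BCS/BdG anomalous bubble has a sign]
-/

set_option linter.dupNamespace false

namespace Summit.HubbardSuperconductivity.HubbardSuperconductivity.Theorems.TwSeededEnsembleEquivalenceR.ColdFloorLine

open Real Set Matrix Literature.MathematicalPhysics.QuantumLattice Literature.Probability.LatticeModels
open scoped ComplexOrder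

/-- **DEEP-SIGN at `U = 0`, exactly, in finite volume.** For `β > 0`, any `μ`, `L ≥ 3` and `h > 0`, the truncated anomalous
Duhamel d-wave pair correlator of the FREE sourced torus is non-positive:
`Re (Δ_d,Δ_d)_{Duh; β, dWaveSourceTorus L 0 μ h} ≤ (Re⟨Δ_d⟩)²`. (Free concavity in the squared source,
`cal_freeConcavity_finiteVolume`, read through the converse Ward dictionary `anomalous_nonpos_of_concaveOn_sq_source` with the
particle-number grading, charge `q = 2`.) [folklore] -/
theorem cal_freeAnomalousSign_finiteVolume (β μ : ℝ) (hβ : 0 < β) (L : ℕ) [NeZero L] (hL : 3 ≤ L) {h : ℝ}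
    (hh : 0 < h) :
    (duhamel β (dWaveSourceTorus L 0 μ h) (pairField dWaveFormFactor L) (pairField dWaveFormFactor L)).re ≤
      (gibbsState β (dWaveSourceTorus L 0 μ h) (pairField dWaveFormFactor L)).re ^ 2 := by
  have hconc0 := cal_freeConcavity_finiteVolume β μ hβ L hL
  have hL0 : (0 : ℝ) < (L : ℝ) := by exact_mod_cast lt_of_lt_of_le (by norm_num : 0 < 3) hL
  have hc : 0 ≤ β * (L : ℝ) ^ 2 := by positivity
  have hne : β * (L : ℝ) ^ 2 ≠ 0 := by positivity
  have hconc1 : ConcaveOn ℝ (Ici (0 : ℝ)) (fun s : ℝ =>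
      Real.log (partitionFn β (dWaveSourceTorus L 0 μ (Real.sqrt s))).re) := by
    refine (hconc0.smul hc).congr ?_
    intro s _
    simp only [smul_eq_mul]
    field_simp
  have hconc2 : ConcaveOn ℝ (Icc ((0 : ℝ) ^ 2) ((h + 1) ^ 2)) (fun s : ℝ =>
      Real.log (partitionFn β (hubbardTorusWith 2 L 1 0 μ -
        ((Real.sqrt s : ℝ) : ℂ) • (pairField dWaveFormFactor L + (pairField dWaveFormFactor L)ᴴ))).re) := by
    refine hconc1.subset (fun s hs => ?_) (convex_Icc _ _)
    have h0 : (0 : ℝ) ^ 2 ≤ s := hs.1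
    simpa using h0
  exact anomalous_nonpos_of_concaveOn_sq_source (isHermitian_hubbardTorusWith L 1 0 μ)
    (diagonal_card_commutator_hubbardTorusWith L 0 μ) (diagonal_card_commutator_pairField L)
    (diagonal_card_commutator_pairField_conjTranspose L) two_ne_zero hβ le_rfl hconc2 h ⟨hh, by linarith⟩

/-- **Calibration of the registered stub DEEP-SIGN at `U = 0`** (the signature of `stub_fvDeepAnomalousSign`, binder for binder,
at the solvable corner: `dWaveSourceTorus L 0 μ h` and any `β > 0` in place of `dWaveSourceTorus L U μ h`, `β = e^{a/U}`). Witnesses: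
`a₁ = K' = U₀ = 1`, `L₀ = 3`; the deep-source restriction is not needed (`cal_freeAnomalousSign_finiteVolume` holds for every `h > 0`).
[folklore] -/
theorem cal_freeDeepAnomalousSign : ∀ (β : ℝ), 0 < β →
    ∀ (μ₁ μ₂ : ℝ), -4 < μ₁ → μ₁ < μ₂ → μ₂ < 0 → ∃ a₁ : ℝ, 0 < a₁ ∧ ∀ a ∈ Set.Ioc (0 : ℝ) a₁,
      ∃ K' U₀ : ℝ, 0 < K' ∧ 0 < U₀ ∧ ∀ U ∈ Set.Ioc (0 : ℝ) U₀, ∀ g ∈ Set.Icc (K' * U) (1 / 10),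
        ∀ μ ∈ Set.Ioo μ₁ μ₂, ∃ L₀ : ℕ, ∀ (L : ℕ) [NeZero L], L₀ ≤ L →
          ∀ h ∈ Set.Ioo (Real.exp (-(a / (4 * U)))) (13 * g + 1),
            (duhamel β (dWaveSourceTorus L 0 μ h) (pairField dWaveFormFactor L) (pairField dWaveFormFactor L)).re ≤
              (gibbsState β (dWaveSourceTorus L 0 μ h) (pairField dWaveFormFactor L)).re ^ 2 := by
  intro β hβ μ₁ μ₂ _ _ _
  refine ⟨1, one_pos, fun a _ => ⟨1, 1, one_pos, one_pos, fun U _ g _ μ _ => ⟨3, fun L _ hL h hh => ?_⟩⟩⟩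
  exact cal_freeAnomalousSign_finiteVolume β μ hβ L hL (lt_trans (Real.exp_pos _) hh.1)

end Summit.HubbardSuperconductivity.HubbardSuperconductivity.Theorems.TwSeededEnsembleEquivalenceR.ColdFloorLine
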